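import Literature.MathematicalPhysics.QuantumFieldTheory.Balaban1983to89.B9Cor36CubeCutoffs
import Literature.MathematicalPhysics.QuantumFieldTheory.Balaban1983to89.B9CubeGeometryInputs

/-!
# `Balaban1983to89.B9Cor36CutoffSecondDiff` — [Balaban1985BackgroundPropagators] COROLLARY 3.6 p. 408 ∕ (3.87)–(3.89) p. 409 AT ONE COVER CUBE □:
# THE SECOND LATTICE DIFFERENCE OF THE INNER CUT-OFF `χ_□` ON THE TORUS — `|∂_μ∂*_μ χ_□| ≤ 3D₂θ∕(4S_j)²` — the window `NearC 4S_j ⊂ NearH`, and the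
# `len`-weighted multiplier sizes `|η⁻¹∂χ_□|·Lⁿη ≤ D₁θ∕4`, `|η⁻²∂∂*χ_□|·(Lⁿη)² ≤ 3D₂θ∕16` — sub-row G-B9-LETTERS, module M5.1b-G′ (site sector),
# FILE 7b-D1 of seat p33's plan

statement-level skeleton of published theorems with citation tags; proofs where landed; nothing here is a claim about the Yang–Mills mass gap

CITATION HEADER (lean-in-tree rule).  B9 = T. Bałaban, *Propagators for lattice gauge theories in a background field*, Commun. Math. Phys. **99** (1985)
389–434 [Balaban1985BackgroundPropagators] (held `paper:balaban1985-cmp99-background-propagators`; journal page = PDF page + 388).  Cor. 3.6 p. 408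
[PDF 20]; (3.87)–(3.89) p. 409 [PDF 21] (`h_□`, `G′₀ = Σ_□ h_□G′_□h_□`, the commutator terms of `Δ_U` with the cut-offs); p. 410 l. 10–15.
[4] = [Balaban1984PropagatorsII] T. Bałaban, Commun. Math. Phys. **96** (1984) 223–250: (2.36) p. 229 (the cover of the torus), p. 247 «|∂h_□| ≤ O(1)(MLʲη)⁻¹,
|Δh_□| ≤ O(1)(MLʲη)⁻²»; [4-I] = [Balaban1984PropagatorsI] (1.118) p. 36 (the profile `h ∈ C₀^∞`, `h = 1` on the plateau); [B83] =
[Balaban1983RegularityDecay] §2 p. 575–577 (the profile `θ`, `sup|θ″|`).  Rows B9.Cor3.6 × B9.Eq3.87 (cells only; no row head changes).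

WHY THIS FILE (cell lit-balaban, sub-row G-B9-LETTERS, module M5.1b-G′ booked to seat p33; design memo `lit-balaban-p33/COR35GP-STATEMENTS-p33.md` v1 §1,
ruling (R)).  FILE 7b (the discharge of M5.5 FILE 6's binder `hE` for the U-constant cube letter `O_□ = χ_□R(u)⁻¹G′_□(Ṽ_□)R(u)χ_□`) needs, for the
Laplacian entry `η⁻²Δ_U(η²O_□)`, the commutator of `Δ_U` with the LEFT cut-off `χ_□`: by the lattice Leibniz rule this produces the multipliers
`η⁻¹∂_μχ_□` (against `∇_{Ṽ}G′_□`, one power of `Lⁿη` to spare) and `η⁻²∂_μ∂*_μχ_□` (against `G′_□` itself, two powers to spare) — print's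
«|∂h_□| ≤ O(1)(MLʲη)⁻¹, |Δh_□| ≤ O(1)(MLʲη)⁻²» ([4] p. 247).  FILE 4 (`B9Cor36CubeCutoffs`) proved the first difference; THIS FILE proves the
SECOND difference of `χ_□ = Π_ν θ(dist(z_ν − m_ν, N_νℤ)∕4S_j)` on the torus, honestly through the antipode: the one-variable function
`t ↦ θ(dist(t, Nℤ)∕ρ)` is `C²` with `|″| ≤ D₂θ∕ρ²` wherever `dist < N∕2`, and AT the antipode `dist = N∕2` it is either identically `1` nearby
(`N∕2 ≤ ¾ρ`) or flat to second order (`N∕2 ≥ ⅞ρ`, where `θ` vanishes with its derivatives); for `ρ = 4S_j` and `N_ν = S_j·q` (`S_j ∣ N_ν`, r05's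
`sI_dvd_N0`) one of the two always holds (`q ≥ 7` or `q ≤ 6`).  It also widens FILE 4's window lemma `NearC 3S_j ⊂ NearH` to `NearC 4S_j ⊂ NearH`
(numerology `4S_j + m_LS_j ≤ widH_j` for `L ≥ 5`), needed because `supp χ_□ ⊂ NearC 3.5S_j`, and packages the `len`-weighted sizes of the
multipliers in the form consumed by FILE 7b-B's `hasMajorant_conj_site_sandwich_decay` (`|g z|·len_□(z)^m ≤ c`).

WHAT IS PROVED (0 `def`s; 0 sorry; 0 new named facts; standard axioms):
* §1 ONE VARIABLE: `thetaProf_le_D2_sq` (flatness at the edge of the support: `θ(x) ≤ D₂θ·u²` for `x ≥ ⅞ − u`), `circR_le_half` (`dist(t, Nℤ) ≤ N∕2`),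
  ★★`abs_second_diff_theta_circR_le` (`|θ(dist(t+1)∕ρ) − 2θ(dist(t)∕ρ) + θ(dist(t−1)∕ρ)| ≤ 3D₂θ∕ρ²` under `⅞ρ ≤ N∕2 ∨ N∕2 ≤ ¾ρ`, `N ≥ 2`);
* §2 THE PRODUCT BUMP: `bumpY_tshift_eq` (coordinates of a translate, periodicity), ★★`abs_bumpY_second_diff_le` (`|χ(z+e_μ) − 2χ(z) + χ(z−e_μ)| ≤ 3D₂θ∕ρ²`:
  only the factor `μ` moves, the others lie in `[0, 1]`);
* §3 THE CUBE'S CUT-OFF: `two_le_NB`, `window_chiY` (the dichotomy from `S_j ∣ N_ν`), ★★`abs_chiY_second_diff_le` (`≤ 3D₂θ∕(4S_j)²`);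
* §4 THE WIDER WINDOW: ★`nearH_of_nearC'` (`NearC r ⊂ NearH` for `r ≤ 4S_j`, `L ≥ 5`), `nearH_of_chiY_ne_zero₃` (`z ∈ NearH` as soon as `χ_□ ≠ 0` at
  `z`, `z + e_μ` or `z − e_μ`);
* §5 WEIGHTED SIZES: `len_blkCubeY_le_SC_mul_eta` (`len_□(z) = L^{lev_□ z}η ≤ S_jη`), `weight_one_mul_len_le` (`|a| ≤ B∕(4S_j) ⇒ |η⁻¹a|·len_□(z) ≤ B∕4`),
  `weight_two_mul_len_sq_le` (`|a| ≤ B∕(4S_j)² ⇒ |η⁻²a|·len_□(z)² ≤ B∕16`), ★`chiY_weights` (the six sizes of `χ_□`, `χ_□(· ± e_μ)`, `η⁻¹∂^{±}_μχ_□`,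
  `η⁻²∂_μ∂*_μχ_□` used by FILE 7b-D2).

PROOF.  Ours (real-variable bookkeeping): `B4PartitionUnity22.abs_second_diff_le_D2` (Taylor to second order for `C₀^∞` functions) off the antipode and
at the support edge, `B6Partition118KLevelTorus.circR_*` (the distance to `Nℤ`), FILE 3's `bumpY`, FILE 4's `SC`∕`NearC`∕`chiY`, r05's cube-sequence
numerology (`B9CubeSequence408`), p05's `geoCK` lengths (`B9CubeGeometryInputs`).

HONEST SCOPE / NOT CLAIMED.  (i) The constants `D₁θ = sup|θ′|`, `D₂θ = sup|θ″|` of [B83]'s profile are not evaluated; `3D₂θ` (not `D₂θ`) absorbs the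
two antipode corrections and is not optimised.  (ii) The dichotomy `⅞ρ ≤ N∕2 ∨ N∕2 ≤ ¾ρ` is exactly what `S_j ∣ N_ν` delivers for `ρ = 4S_j`; for a
general radius the lemma is stated with the dichotomy as a hypothesis.  (iii) `L ≥ 5` (`KIdx.hℓ`) is used for the window `4S_j`; FILE 4's `3S_j` needed
only `L ≥ 3`.  Nothing on `d = 4`, the continuum, reflection positivity or the mass gap; NOT a node discharge; no row head changes.

RELATED IN THE TREE, NOT DUPLICATED: FILE 4 `B9Cor36CubeCutoffs` (first differences `abs_chi_shiftY_sub_le`, window `nearH_of_nearC` for `r ≤ 3S_j` —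
consumed BY NAME), FILE 3 `B9Cor36CutoffField337` (`bumpY`, `abs_bumpY_tshift_sub_le`), `B4PartitionUnity22` (`θ`, `D₁`, `D₂`).
-/

noncomputable section

namespace Literature.MathematicalPhysics.QuantumFieldTheory.Balaban1983to89.B9Cor36CutoffSecondDiff

open Literature.MathematicalPhysics.QuantumFieldTheory.Balaban1983to89
open Literature.MathematicalPhysics.QuantumFieldTheory.Balaban1983to89.B4PartitionUnity22 (thetaProf thetaProf_nonneg thetaProf_le_one thetaProf_eq_one
  thetaProf_eq_zero thetaProf_neg D1 D2 D1_nonneg D2_nonneg contDiff_thetaProf hasCompactSupport_thetaProf abs_second_diff_le_D2)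
open Literature.MathematicalPhysics.QuantumFieldTheory.Balaban1983to89.B6Partition118KLevelTorus (circR circR_nonneg circR_add_mul circR_le_abs
  circR_ge_of_abs_le)
open Literature.MathematicalPhysics.QuantumFieldTheory.Balaban1983to89.B6MultiLevelBoxOperator (N0 bigSide)
open Literature.MathematicalPhysics.QuantumFieldTheory.Balaban1983to89.B6MultiLevelTorusOperator (tshift tshift_val_eq_translate tshift_symm_apply unitVec
  one_le_of_mem one_le_N0)
open Literature.MathematicalPhysics.QuantumFieldTheory.Balaban1983to89.B6Cover236MultiLevelBlocks (cubes)
open Literature.MathematicalPhysics.QuantumFieldTheory.Balaban1983to89.B6KLevelCensusIndexV1 (KIdx kGeo)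
open Literature.MathematicalPhysics.QuantumFieldTheory.Balaban1983to89.B4TorusKernel.MultiPeriod (circAbs circAbs_le_abs)
open Literature.MathematicalPhysics.QuantumFieldTheory.Balaban1983to89.B4Sect5Torus (circAbs_add_le)
open Literature.MathematicalPhysics.QuantumFieldTheory.Balaban1983to89.B9CubeSequence408 (sI hf mL widH ctrC ctrH NearH sI_pos two_mul_hf_add_one
  two_mul_mL abs_ctrC_sub_ctrH_le lev_cubeFam_le_succ cube_level_le sI_dvd_N0)
open Literature.MathematicalPhysics.QuantumFieldTheory.Balaban1983to89.B9CubeLettersOpsL0 (oddMh cubeFamY levCubeY)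
open Literature.MathematicalPhysics.QuantumFieldTheory.Balaban1983to89.B9Eq360DeltaPrimeACubeY (blkCubeY)
open Literature.MathematicalPhysics.QuantumFieldTheory.Balaban1983to89.B9CubeGeometryInputs (geoCK geoCK_len_blkCubeY geoCK_len_pos geoCK_eta geoCK_eta_pos)
open Literature.MathematicalPhysics.QuantumFieldTheory.Balaban1983to89.B9Cor36CutoffField337 (bumpY bumpY_apply)
open Literature.MathematicalPhysics.QuantumFieldTheory.Balaban1983to89.B9Cor36CubeCutoffs (SC NearC ctrR chiY one_le_SC nine_le_SC abs_chi_shiftY_sub_le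
  abs_chiY_le_one nearC_of_chiY_ne_zero nearC_shiftY nearC_shiftY_symm)
open Literature.MathematicalPhysics.QuantumFieldTheory.Balaban1983to89.Node00 (SiteY toKT shiftY)

variable {d ℓ : ℕ} {hd : 1 ≤ d + 1} {hL : Odd (ℓ + 1) ∧ 1 < ℓ + 1} {b₀ b₁ : ℝ}

/-! ## §1  One variable: `t ↦ θ(dist(t, Nℤ)∕ρ)` has second differences `≤ 3D₂θ∕ρ²` off and through the antipode -/

/-- **FLATNESS OF `θ` AT THE EDGE OF ITS SUPPORT**: `θ(x) ≤ D₂θ·u²` for `x ≥ ⅞ − u` (`θ(⅞) = θ(⅞ + u′) = 0`, Taylor to second order at `⅞`).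
[cite: Balaban1983RegularityDecay, §2 p.575–577 («θ ∈ C₀^∞», «|Δh| ≤ O(M⁻²)»); Balaban1984PropagatorsI, (1.118) p.36] -/
theorem thetaProf_le_D2_sq {x u : ℝ} (hx : 7 / 8 - u ≤ x) : thetaProf x ≤ D2 thetaProf * u ^ 2 := by
  have hD := D2_nonneg contDiff_thetaProf hasCompactSupport_thetaProf
  by_cases h : 7 / 8 ≤ x
  · rw [thetaProf_eq_zero (h.trans (le_abs_self x))]; positivity
  · rw [not_le] at h
    set u' : ℝ := 7 / 8 - x with hu'
    have hu'0 : 0 < u' := by linarith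
    have hu'u : u' ≤ u := by linarith
    have h0 : thetaProf (7 / 8) = 0 := thetaProf_eq_zero (by rw [abs_of_nonneg (by norm_num)])
    have h1 : thetaProf (7 / 8 + u') = 0 := thetaProf_eq_zero (by rw [abs_of_nonneg (by linarith)]; linarith)
    have h2 := abs_second_diff_le_D2 contDiff_thetaProf hasCompactSupport_thetaProf (7 / 8) u'
    rw [h1, h0, mul_zero, sub_zero, zero_add, show (7 : ℝ) / 8 - u' = x by linarith] at h2
    calc thetaProf x ≤ |thetaProf x| := le_abs_self _
      _ ≤ D2 thetaProf * u' ^ 2 := h2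
      _ ≤ D2 thetaProf * u ^ 2 := mul_le_mul_of_nonneg_left (pow_le_pow_left₀ hu'0.le hu'u 2) hD

/-- `dist(t, Nℤ) ≤ N∕2`. [cite: Balaban1984PropagatorsII, (2.36) p.229 (torus distance), dictionary] -/
theorem circR_le_half {N : ℕ} (hN : 1 ≤ N) (t : ℝ) : circR N t ≤ (N : ℝ) / 2 := by
  have hN' : (0 : ℝ) < N := by exact_mod_cast hN
  unfold circR
  have h := abs_sub_round (t / N)
  have e : t - N * round (t / N) = N * (t / N - round (t / N)) := by field_simp
  rw [e, abs_mul, abs_of_pos hN']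
  calc (N : ℝ) * |t / N - round (t / N)| ≤ N * (1 / 2) := mul_le_mul_of_nonneg_left h hN'.le
    _ = N / 2 := by ring

/-- `θ(x∕ρ) = θ(|x|∕ρ)` (`θ` is even). [cite: Balaban1983RegularityDecay, §2 p.575, bookkeeping] -/
theorem thetaProf_div_eq_abs (x ρ : ℝ) : thetaProf (x / ρ) = thetaProf (|x| / ρ) := by
  rcases le_or_gt 0 x with h | h
  · rw [abs_of_nonneg h]
  · rw [abs_of_neg h, neg_div, thetaProf_neg]

/-- ★★ **THE SECOND DIFFERENCE OF `t ↦ θ(dist(t, Nℤ)∕ρ)` THROUGH THE ANTIPODE**: under `⅞ρ ≤ N∕2` (the bump dies before the antipode, where the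
composite is flat to second order) or `N∕2 ≤ ¾ρ` (the composite is identically `1`), `|θ(dist(t+1)∕ρ) − 2θ(dist(t)∕ρ) + θ(dist(t−1)∕ρ)| ≤ 3D₂θ∕ρ²`.
[cite: Balaban1984PropagatorsII, p.247 («|Δh_□| ≤ O(1)(MLʲη)⁻²»), (2.36) p.229; Balaban1983RegularityDecay, §2 p.577] -/
theorem abs_second_diff_theta_circR_le {N : ℕ} (hN : 2 ≤ N) {ρ : ℝ} (hρ : 0 < ρ)
    (hwin : 7 / 8 * ρ ≤ (N : ℝ) / 2 ∨ (N : ℝ) / 2 ≤ 3 / 4 * ρ) (t : ℝ) :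
    |thetaProf (circR N (t + 1) / ρ) - 2 * thetaProf (circR N t / ρ) + thetaProf (circR N (t - 1) / ρ)| ≤ 3 * D2 thetaProf / ρ ^ 2 := by
  have hN1 : 1 ≤ N := by omega
  have hN2 : (2 : ℝ) ≤ N := by exact_mod_cast hN
  have hD := D2_nonneg contDiff_thetaProf hasCompactSupport_thetaProf
  rcases hwin with hA | hB
  · set s : ℝ := t - N * round (t / N) with hs
    have hst : circR N t = |s| := rfl
    have hsN : |s| ≤ N / 2 := by rw [← hst]; exact circR_le_half hN1 t
    have hred : ∀ k : ℝ, circR N (t + k) = circR N (s + k) := by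
      intro k
      have e : t + k = (s + k) + N * ((round (t / N) : ℤ) : ℝ) := by rw [hs]; ring
      rw [e, circR_add_mul hN1]
    have herr : ∀ k : ℝ, |k| ≤ 1 → |thetaProf (circR N (s + k) / ρ) - thetaProf ((s + k) / ρ)| ≤ D2 thetaProf / ρ ^ 2 := by
      intro k hk
      have hsk' : |s + k| ≤ N / 2 + 1 := (abs_add_le _ _).trans (by linarith)
      have hsk : |s + k| ≤ N := hsk'.trans (by linarith)
      rcases circR_ge_of_abs_le hN1 hsk with h | h
      · have hc := circR_le_abs hN1 (s + k)
        have hz1 : thetaProf ((s + k) / ρ) = 0 := by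
          rw [thetaProf_div_eq_abs]
          apply thetaProf_eq_zero
          rw [abs_div, abs_abs, abs_of_pos hρ, le_div_iff₀ hρ]; linarith
        have h2 : 7 / 8 - 1 / ρ ≤ circR N (s + k) / ρ := by
          rw [sub_le_iff_le_add, ← add_div, le_div_iff₀ hρ]; linarith
        have h3 := thetaProf_le_D2_sq (u := 1 / ρ) h2
        rw [hz1, sub_zero, abs_of_nonneg (thetaProf_nonneg _)]
        calc thetaProf (circR N (s + k) / ρ) ≤ D2 thetaProf * (1 / ρ) ^ 2 := h3
          _ = D2 thetaProf / ρ ^ 2 := by ring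
      · rw [h, ← thetaProf_div_eq_abs, sub_self, abs_zero]; positivity
    have hmain := abs_second_diff_le_D2 contDiff_thetaProf hasCompactSupport_thetaProf (s / ρ) (1 / ρ)
    have e1 : s / ρ + 1 / ρ = (s + 1) / ρ := by rw [add_div]
    have e2 : s / ρ - 1 / ρ = (s + -1) / ρ := by rw [add_div, neg_div]; ring
    rw [e1, e2] at hmain
    have hθs : thetaProf (circR N t / ρ) = thetaProf (s / ρ) := by rw [hst, ← thetaProf_div_eq_abs]
    have et1 : circR N (t + 1) = circR N (s + 1) := hred 1
    have et2 : circR N (t - 1) = circR N (s + -1) := by rw [sub_eq_add_neg]; exact hred (-1)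
    rw [et1, et2, hθs]
    have hE1 := herr 1 (by norm_num)
    have hE2 := herr (-1) (by norm_num)
    have key : thetaProf (circR N (s + 1) / ρ) - 2 * thetaProf (s / ρ) + thetaProf (circR N (s + -1) / ρ)
        = (thetaProf ((s + 1) / ρ) - 2 * thetaProf (s / ρ) + thetaProf ((s + -1) / ρ))
          + ((thetaProf (circR N (s + 1) / ρ) - thetaProf ((s + 1) / ρ))
          + (thetaProf (circR N (s + -1) / ρ) - thetaProf ((s + -1) / ρ))) := by ring
    rw [key]
    calc _ ≤ |thetaProf ((s + 1) / ρ) - 2 * thetaProf (s / ρ) + thetaProf ((s + -1) / ρ)|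
          + (|thetaProf (circR N (s + 1) / ρ) - thetaProf ((s + 1) / ρ)|
          + |thetaProf (circR N (s + -1) / ρ) - thetaProf ((s + -1) / ρ)|) :=
          (abs_add_le _ _).trans (by gcongr; exact abs_add_le _ _)
      _ ≤ D2 thetaProf * (1 / ρ) ^ 2 + (D2 thetaProf / ρ ^ 2 + D2 thetaProf / ρ ^ 2) := add_le_add hmain (add_le_add hE1 hE2)
      _ = 3 * D2 thetaProf / ρ ^ 2 := by ring
  · have h1 : ∀ t', thetaProf (circR N t' / ρ) = 1 := by
      intro t'
      apply thetaProf_eq_one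
      rw [abs_div, abs_of_pos hρ, abs_of_nonneg (circR_nonneg _ _), div_le_iff₀ hρ]
      have := circR_le_half hN1 t'
      linarith
    rw [h1, h1, h1]
    norm_num
    positivity

/-! ## §2  The product bump: only the factor `μ` moves under `z ↦ z ± e_μ` -/

section Bump

variable (i : KIdx d ℓ hd hL b₀ b₁)

/-- the factors of `χ` at a translate `z + t`: `θ(dist(z_ν − m_ν + t_ν, N_νℤ)∕ρ)` (periodicity absorbs the wrap).
[cite: Balaban1984PropagatorsII, (2.36) p.229, bookkeeping] -/
theorem bumpY_tshift_eq (m : Fin (d + 1) → ℝ) (ρ : ℝ) (t : Fin (d + 1) → ℤ) (z : SiteY i) :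
    bumpY i m ρ (tshift (toKT i).NB t z) = ∏ ν, thetaProf (circR ((toKT i).NB ν) ((z.1 ν : ℝ) - m ν + t ν) / ρ) := by
  have hN : ∀ ν, 1 ≤ (toKT i).NB ν := one_le_of_mem z.2
  obtain ⟨mm, hmm⟩ := tshift_val_eq_translate (toKT i).NB t z
  rw [bumpY_apply]
  refine Finset.prod_congr rfl fun ν _ => ?_
  have hcoord : ((tshift (toKT i).NB t z).1 ν : ℝ) - m ν = ((z.1 ν : ℝ) - m ν + t ν) + ((toKT i).NB ν : ℝ) * (mm ν : ℤ) := by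
    rw [hmm]; simp only [B4TorusKernel.MultiPeriod.translate, Pi.add_apply]; push_cast; ring
  rw [hcoord, circR_add_mul (hN ν)]

/-- ★★ **THE SECOND DIFFERENCE OF THE PRODUCT BUMP ALONG `e_μ`**: `|χ(z + e_μ) − 2χ(z) + χ(z − e_μ)| ≤ 3D₂θ∕ρ²` (only the factor `μ` moves; the other
factors lie in `[0, 1]`), under the antipode dichotomy in every direction. [cite: Balaban1984PropagatorsII, p.247 («|Δh_□| ≤ O(1)(MLʲη)⁻²»), (2.36) p.229; Balaban1984PropagatorsI, (1.118) p.36] -/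
theorem abs_bumpY_second_diff_le (m : Fin (d + 1) → ℝ) {ρ : ℝ} (hρ : 0 < ρ) (hN2 : ∀ ν, 2 ≤ (toKT i).NB ν)
    (hwin : ∀ ν, 7 / 8 * ρ ≤ ((toKT i).NB ν : ℝ) / 2 ∨ ((toKT i).NB ν : ℝ) / 2 ≤ 3 / 4 * ρ) (μ : Fin (d + 1)) (z : SiteY i) :
    |bumpY i m ρ (shiftY i μ z) - 2 * bumpY i m ρ z + bumpY i m ρ ((shiftY i μ).symm z)| ≤ 3 * D2 thetaProf / ρ ^ 2 := by
  have e1 : shiftY i μ z = tshift (toKT i).NB ((1 : ℤ) • unitVec μ) z := by rw [one_smul]; rfl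
  have e2 : (shiftY i μ).symm z = tshift (toKT i).NB ((-1 : ℤ) • unitVec μ) z := by
    rw [neg_one_smul]; exact tshift_symm_apply _ _ _
  set f : Fin (d + 1) → ℤ → ℝ := fun ν k => thetaProf (circR ((toKT i).NB ν) ((z.1 ν : ℝ) - m ν + k) / ρ) with hf
  have hval : ∀ s : ℤ, bumpY i m ρ (tshift (toKT i).NB (s • unitVec μ) z) = f μ s * ∏ ν ∈ Finset.univ.erase μ, f ν 0 := by
    intro s
    rw [bumpY_tshift_eq, ← Finset.mul_prod_erase Finset.univ _ (Finset.mem_univ μ)]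
    congr 1
    · simp [hf, unitVec]
    · refine Finset.prod_congr rfl fun ν hν => ?_
      have hne : ν ≠ μ := Finset.ne_of_mem_erase hν
      simp [hf, unitVec, hne]
  have hz : bumpY i m ρ z = f μ 0 * ∏ ν ∈ Finset.univ.erase μ, f ν 0 := by
    simp only [hf, Int.cast_zero, add_zero]
    rw [bumpY_apply]
    exact (Finset.mul_prod_erase Finset.univ _ (Finset.mem_univ μ)).symm
  rw [e1, e2, hval, hval, hz]
  set P : ℝ := ∏ ν ∈ Finset.univ.erase μ, f ν 0 with hP
  have hP0 : 0 ≤ P := Finset.prod_nonneg fun _ _ => thetaProf_nonneg _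
  have hP1 : P ≤ 1 := Finset.prod_le_one (fun _ _ => thetaProf_nonneg _) fun _ _ => thetaProf_le_one _
  have h1d := abs_second_diff_theta_circR_le (hN2 μ) hρ (hwin μ) ((z.1 μ : ℝ) - m μ)
  have ef1 : f μ 1 = thetaProf (circR ((toKT i).NB μ) ((z.1 μ : ℝ) - m μ + 1) / ρ) := by simp [hf]
  have ef2 : f μ (-1) = thetaProf (circR ((toKT i).NB μ) ((z.1 μ : ℝ) - m μ - 1) / ρ) := by simp [hf, sub_eq_add_neg]
  have ef0 : f μ 0 = thetaProf (circR ((toKT i).NB μ) ((z.1 μ : ℝ) - m μ) / ρ) := by simp [hf]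
  rw [← ef1, ← ef0, ← ef2] at h1d
  have key : f μ 1 * P - 2 * (f μ 0 * P) + f μ (-1) * P = (f μ 1 - 2 * f μ 0 + f μ (-1)) * P := by ring
  rw [key, abs_mul, abs_of_nonneg hP0]
  have h3 : 0 ≤ 3 * D2 thetaProf / ρ ^ 2 := by
    have := D2_nonneg contDiff_thetaProf hasCompactSupport_thetaProf; positivity
  calc |f μ 1 - 2 * f μ 0 + f μ (-1)| * P ≤ 3 * D2 thetaProf / ρ ^ 2 * 1 := mul_le_mul h1d hP1 hP0 h3
    _ = 3 * D2 thetaProf / ρ ^ 2 := mul_one _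

end Bump

/-! ## §3  The cube's inner cut-off `χ_□ = bumpY (ctr β) (4S_j)`: the dichotomy from `S_j ∣ N_ν` -/

section Cube

variable (i : KIdx d ℓ hd hL b₀ b₁) (c : ↥(cubes (toKT i).D.toDomains))

/-- `N_ν = S_j·q` with `q ≥ 1` (r05's `sI_dvd_N0`: the big blocks of level `j ≤ k` tile the torus). [cite: Balaban1984PropagatorsII, (2.1) p.224, bookkeeping] -/
theorem NB_eq_SC_mul (ν : Fin (d + 1)) : ∃ q : ℤ, 1 ≤ q ∧ ((toKT i).NB ν : ℤ) = SC i c * q := by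
  obtain ⟨q, hq⟩ := sI_dvd_N0 (ℓ := ℓ) (Mh := (toKT i).Mh) (toKT i).P (cube_level_le c) ν
  have hq' : ((toKT i).NB ν : ℤ) = SC i c * q := hq
  have hN1 : 1 ≤ (toKT i).NB ν := one_le_of_mem_NB i ν
  have hN1' : (1 : ℤ) ≤ ((toKT i).NB ν : ℤ) := by exact_mod_cast hN1
  have h9 := nine_le_SC i c
  refine ⟨q, ?_, hq'⟩
  by_contra h
  rw [not_le] at h
  rw [hq'] at hN1'
  nlinarith
where
  /-- `1 ≤ N_ν`. [cite: Balaban1984PropagatorsII, (2.1) p.224, bookkeeping] -/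
  one_le_of_mem_NB (i : KIdx d ℓ hd hL b₀ b₁) (ν : Fin (d + 1)) : 1 ≤ (toKT i).NB ν := by
    show 1 ≤ N0 ℓ (toKT i).Mh (toKT i).k (toKT i).P ν
    exact one_le_N0 (toKT i).hMh (toKT i).hP ν

include c in
/-- `N_ν ≥ 2` (indeed `≥ S_j ≥ 9`). [cite: Balaban1984PropagatorsII, (2.1) p.224, bookkeeping] -/
theorem two_le_NB (ν : Fin (d + 1)) : 2 ≤ (toKT i).NB ν := by
  obtain ⟨q, hq1, hq⟩ := NB_eq_SC_mul i c ν
  have h9 := nine_le_SC i c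
  have h : (2 : ℤ) ≤ ((toKT i).NB ν : ℤ) := by rw [hq]; nlinarith
  exact_mod_cast h

/-- **THE ANTIPODE DICHOTOMY FOR `ρ = 4S_j`**: `⅞·4S_j ≤ N_ν∕2` (`q ≥ 7`) or `N_ν∕2 ≤ ¾·4S_j` (`q ≤ 6`). [cite: Balaban1984PropagatorsII, (2.1) p.224, (2.36) p.229, bookkeeping] -/
theorem window_chiY (ν : Fin (d + 1)) :
    7 / 8 * (4 * (SC i c : ℝ)) ≤ ((toKT i).NB ν : ℝ) / 2 ∨ ((toKT i).NB ν : ℝ) / 2 ≤ 3 / 4 * (4 * (SC i c : ℝ)) := by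
  obtain ⟨q, hq1, hq⟩ := NB_eq_SC_mul i c ν
  have hS : (1 : ℝ) ≤ (SC i c : ℝ) := by exact_mod_cast one_le_SC i c
  have hr : ((toKT i).NB ν : ℝ) = (SC i c : ℝ) * (q : ℝ) := by exact_mod_cast hq
  rw [hr]
  rcases le_or_gt 7 q with h7 | h6
  · left
    have h7' : (7 : ℝ) ≤ q := by exact_mod_cast h7
    nlinarith
  · right
    have h6' : (q : ℝ) ≤ 6 := by exact_mod_cast (show q ≤ 6 by omega)
    nlinarith

/-- ★★ **THE SECOND DIFFERENCE OF `χ_□`**: `|χ_□(z + e_μ) − 2χ_□(z) + χ_□(z − e_μ)| ≤ 3D₂θ∕(4S_j)²` (print: `|Δh_□| ≤ O(1)(MLʲη)⁻²`).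
[cite: Balaban1984PropagatorsII, p.247 («|Δh_□| ≤ O(1)(MLʲη)⁻²»); Balaban1985BackgroundPropagators, (3.89) p.409] -/
theorem abs_chiY_second_diff_le (μ : Fin (d + 1)) (z : SiteY i) :
    |chiY i c (shiftY i μ z) - 2 * chiY i c z + chiY i c ((shiftY i μ).symm z)| ≤ 3 * D2 thetaProf / (4 * (SC i c : ℝ)) ^ 2 := by
  have hS : (1 : ℝ) ≤ (SC i c : ℝ) := by exact_mod_cast one_le_SC i c
  exact abs_bumpY_second_diff_le i _ (by positivity) (two_le_NB i c) (window_chiY i c) μ z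

/-! ## §4  The wider window `NearC 4S_j ⊂ NearH` (`L ≥ 5`) -/

/-- ★ **`NearC r ⊂ NearH` FOR `r ≤ 4S_j`** (the numerology `4S_j + m_LS_j ≤ widH_j = 3(L·hf_j + m_L) + 1`, valid for `L ≥ 5`; FILE 4 proved `r ≤ 3S_j`).
[cite: Balaban1985BackgroundPropagators, p.408 («□̃ … of the size of three big cubes»); Balaban1984PropagatorsII, (2.36) p.229] -/
theorem nearH_of_nearC' {r : ℤ} (hr : r ≤ 4 * SC i c) {x : Fin (d + 1) → ℤ} (hx : NearC i c r x) : NearH c x := by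
  intro μ
  have hN : 1 ≤ (toKT i).NB μ := NB_eq_SC_mul.one_le_of_mem_NB i μ
  have h1 : circAbs ((toKT i).NB μ) (x μ - ctrC c μ) ≤ 4 * SC i c := (hx μ).trans hr
  have h2 : circAbs ((toKT i).NB μ) (ctrC c μ - ctrH c μ) ≤ mL ℓ * sI ℓ (toKT i).Mh c.1.1 :=
    (circAbs_le_abs hN _).trans (abs_ctrC_sub_ctrH_le hL.1 (oddMh i) (toKT i).hMh c μ)
  have h3 := circAbs_add_le hN (x μ - ctrC c μ) (ctrC c μ - ctrH c μ)
  rw [show x μ - ctrC c μ + (ctrC c μ - ctrH c μ) = x μ - ctrH c μ by ring] at h3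
  have e1 := two_mul_hf_add_one hL.1 (oddMh i) c.1.1
  have e2 := two_mul_mL (ℓ := ℓ) hL.1
  have hm : 2 ≤ mL ℓ := by have := i.hℓ; omega
  have hS := one_le_SC i c
  have hhf : 0 ≤ hf ℓ (toKT i).Mh c.1.1 := by unfold SC at hS; linarith
  show circAbs (N0 ℓ (toKT i).Mh (toKT i).k (toKT i).P μ) (x μ - ctrH c μ) ≤ widH ℓ (toKT i).Mh c.1.1
  unfold widH
  unfold SC at h1 hS
  have h3' : circAbs ((toKT i).NB μ) (x μ - ctrH c μ) ≤ 4 * sI ℓ (toKT i).Mh c.1.1 + mL ℓ * sI ℓ (toKT i).Mh c.1.1 := by linarith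
  have key : 4 * sI ℓ (toKT i).Mh c.1.1 + mL ℓ * sI ℓ (toKT i).Mh c.1.1 ≤ 3 * (((ℓ : ℤ) + 1) * hf ℓ (toKT i).Mh c.1.1 + mL ℓ) + 1 := by
    rw [← e1, ← e2]
    nlinarith [mul_nonneg hhf (show (0 : ℤ) ≤ mL ℓ - 2 by linarith)]
  exact h3'.trans key

/-- `z ∈ NearH` as soon as `χ_□ ≠ 0` at `z`, at `z + e_μ` or at `z − e_μ` (`supp χ_□ ⊂ NearC 3.5S_j`, one step costs `1`, `3.5S_j + 1 ≤ 4S_j`).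
[cite: Balaban1985BackgroundPropagators, (3.87) p.409, p.410 L14–15; Balaban1984PropagatorsI, (1.118) p.36] -/
theorem nearH_of_chiY_ne_zero₃ (μ : Fin (d + 1)) (z : SiteY i)
    (h : chiY i c z ≠ 0 ∨ chiY i c (shiftY i μ z) ≠ 0 ∨ chiY i c ((shiftY i μ).symm z) ≠ 0) : NearH c z.1 := by
  have hS := nine_le_SC i c
  have hr : 7 * SC i c / 2 + 1 ≤ 4 * SC i c := by omega
  have hr' : 7 * SC i c / 2 ≤ 4 * SC i c := by omega
  rcases h with h | h | h
  · exact nearH_of_nearC' i c hr' (nearC_of_chiY_ne_zero i c h)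
  · have h1 := nearC_shiftY_symm i c (nearC_of_chiY_ne_zero i c h) μ
    rw [Equiv.symm_apply_apply] at h1
    exact nearH_of_nearC' i c hr h1
  · have h1 := nearC_shiftY i c (nearC_of_chiY_ne_zero i c h) μ
    rw [Equiv.apply_symm_apply] at h1
    exact nearH_of_nearC' i c hr h1

/-! ## §5  The `len`-weighted sizes of the multipliers (FILE 7b-B's `|g z|·len_□(z)^m ≤ c`) -/

/-- `len_□(z) = L^{lev_□ z}η ≤ S_jη` (`lev_□ z ≤ j + 1`, `L^{j+1} ≤ M_hL^{j+1} = S_j`), and `0 < len_□(z)`. [cite: Balaban1985BackgroundPropagators, p.408 («{Ω_n(□)}_{n=0,…,j+1}»), (3.41) p.397] -/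
theorem len_blkCubeY_le_SC_mul_eta (z : SiteY i) :
    0 < (geoCK i c).len (blkCubeY i c z) ∧ (geoCK i c).len (blkCubeY i c z) ≤ (SC i c : ℝ) * (kGeo i).eta := by
  refine ⟨geoCK_len_pos i c _, ?_⟩
  obtain ⟨hlen, hlev⟩ := geoCK_len_blkCubeY i c z
  rw [hlen]
  have hη : 0 < (kGeo i).eta := by rw [← geoCK_eta i c]; exact geoCK_eta_pos i c
  refine mul_le_mul_of_nonneg_right ?_ hη.le
  have h1 : ((ℓ : ℝ) + 1) ^ levCubeY i c z ≤ ((ℓ : ℝ) + 1) ^ (c.1.1 + 1) :=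
    pow_le_pow_right₀ (by linarith [(Nat.cast_nonneg ℓ : (0 : ℝ) ≤ ℓ)]) hlev
  have h2 : (((ℓ + 1) ^ (c.1.1 + 1) : ℕ) : ℤ) ≤ SC i c := by
    show (((ℓ + 1) ^ (c.1.1 + 1) : ℕ) : ℤ) ≤ ((bigSide ℓ (toKT i).Mh c.1.1 : ℕ) : ℤ)
    unfold bigSide
    exact_mod_cast Nat.le_mul_of_pos_left _ (by have := (toKT i).hMh; omega)
  have h2' : ((ℓ : ℝ) + 1) ^ (c.1.1 + 1) ≤ (SC i c : ℝ) := by exact_mod_cast h2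
  exact h1.trans h2'

/-- field arithmetic. [folklore] -/
private theorem aux_one {η S B : ℝ} (hη : 0 < η) (hS : 0 < S) : η⁻¹ * (B / (4 * S)) * (S * η) = B / 4 := by
  field_simp

/-- field arithmetic. [folklore] -/
private theorem aux_two {η S B : ℝ} (hη : 0 < η) (hS : 0 < S) : (η ^ 2)⁻¹ * (B / (4 * S) ^ 2) * ((S * η) ^ 2) = B / 16 := by
  field_simp
  ring

/-- **ONE POWER TO SPARE**: `|a| ≤ B∕(4S_j) ⇒ |η⁻¹a|·len_□(z) ≤ B∕4`. [cite: Balaban1984PropagatorsII, p.247 («|∂h_□| ≤ O(1)(MLʲη)⁻¹»), bookkeeping] -/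
theorem weight_one_mul_len_le {a B : ℝ} (hB : 0 ≤ B) (ha : |a| ≤ B / (4 * (SC i c : ℝ))) (z : SiteY i) :
    |((kGeo i).eta)⁻¹ * a| * (geoCK i c).len (blkCubeY i c z) ≤ B / 4 := by
  obtain ⟨hpos, hle⟩ := len_blkCubeY_le_SC_mul_eta i c z
  have hη : 0 < (kGeo i).eta := by rw [← geoCK_eta i c]; exact geoCK_eta_pos i c
  have hS : (1 : ℝ) ≤ (SC i c : ℝ) := by exact_mod_cast one_le_SC i c
  rw [abs_mul, abs_inv, abs_of_pos hη]
  calc ((kGeo i).eta)⁻¹ * |a| * (geoCK i c).len (blkCubeY i c z)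
      ≤ ((kGeo i).eta)⁻¹ * (B / (4 * (SC i c : ℝ))) * ((SC i c : ℝ) * (kGeo i).eta) :=
        mul_le_mul (mul_le_mul_of_nonneg_left ha (inv_pos.mpr hη).le) hle hpos.le (by positivity)
    _ = B / 4 := aux_one hη (by positivity)
/-- **TWO POWERS TO SPARE**: `|a| ≤ B∕(4S_j)² ⇒ |η⁻²a|·len_□(z)² ≤ B∕16`. [cite: Balaban1984PropagatorsII, p.247 («|Δh_□| ≤ O(1)(MLʲη)⁻²»), bookkeeping] -/
theorem weight_two_mul_len_sq_le {a B : ℝ} (hB : 0 ≤ B) (ha : |a| ≤ B / (4 * (SC i c : ℝ)) ^ 2) (z : SiteY i) :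
    |((kGeo i).eta ^ 2)⁻¹ * a| * (geoCK i c).len (blkCubeY i c z) ^ 2 ≤ B / 16 := by
  obtain ⟨hpos, hle⟩ := len_blkCubeY_le_SC_mul_eta i c z
  have hη : 0 < (kGeo i).eta := by rw [← geoCK_eta i c]; exact geoCK_eta_pos i c
  have hS : (1 : ℝ) ≤ (SC i c : ℝ) := by exact_mod_cast one_le_SC i c
  have hle2 : (geoCK i c).len (blkCubeY i c z) ^ 2 ≤ ((SC i c : ℝ) * (kGeo i).eta) ^ 2 := pow_le_pow_left₀ hpos.le hle 2
  rw [abs_mul, abs_inv, abs_of_pos (by positivity : (0 : ℝ) < (kGeo i).eta ^ 2)]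
  calc ((kGeo i).eta ^ 2)⁻¹ * |a| * (geoCK i c).len (blkCubeY i c z) ^ 2
      ≤ ((kGeo i).eta ^ 2)⁻¹ * (B / (4 * (SC i c : ℝ)) ^ 2) * (((SC i c : ℝ) * (kGeo i).eta) ^ 2) :=
        mul_le_mul (mul_le_mul_of_nonneg_left ha (by positivity)) hle2 (by positivity) (by positivity)
    _ = B / 16 := aux_two hη (by positivity)

/-- ★ **THE SIX SIZES OF THE CUT-OFF MULTIPLIERS** used by FILE 7b-D2: `|χ_□|, |χ_□(· + e_μ)|, |χ_□(· − e_μ)| ≤ 1`; `|η⁻¹∂^{±}_μχ_□|·len_□ ≤ D₁θ∕4`;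
`|η⁻²(χ_□(· + e_μ) − 2χ_□ + χ_□(· − e_μ))|·len_□² ≤ 3D₂θ∕16`. [cite: Balaban1984PropagatorsII, p.247 («|∂h_□| ≤ O(1)(MLʲη)⁻¹, |Δh_□| ≤ O(1)(MLʲη)⁻²»); Balaban1985BackgroundPropagators, (3.89) p.409] -/
theorem chiY_weights (μ : Fin (d + 1)) (z : SiteY i) :
    |chiY i c z| ≤ 1 ∧ |chiY i c (shiftY i μ z)| ≤ 1 ∧ |chiY i c ((shiftY i μ).symm z)| ≤ 1 ∧
    |((kGeo i).eta)⁻¹ * (chiY i c (shiftY i μ z) - chiY i c z)| * (geoCK i c).len (blkCubeY i c z) ≤ D1 thetaProf / 4 ∧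
    |((kGeo i).eta)⁻¹ * (chiY i c ((shiftY i μ).symm z) - chiY i c z)| * (geoCK i c).len (blkCubeY i c z) ≤ D1 thetaProf / 4 ∧
    |((kGeo i).eta ^ 2)⁻¹ * (chiY i c (shiftY i μ z) - 2 * chiY i c z + chiY i c ((shiftY i μ).symm z))|
      * (geoCK i c).len (blkCubeY i c z) ^ 2 ≤ 3 * D2 thetaProf / 16 := by
  have hD1 := D1_nonneg contDiff_thetaProf hasCompactSupport_thetaProf
  have hD2 := D2_nonneg contDiff_thetaProf hasCompactSupport_thetaProf
  obtain ⟨h1, h2, -, -⟩ := abs_chi_shiftY_sub_le i c μ z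
  refine ⟨(abs_chiY_le_one i c z).1, (abs_chiY_le_one i c _).1, (abs_chiY_le_one i c _).1,
    weight_one_mul_len_le i c hD1 h1 z, weight_one_mul_len_le i c hD1 h2 z, ?_⟩
  have h := weight_two_mul_len_sq_le i c (B := 3 * D2 thetaProf) (by positivity) (by simpa using abs_chiY_second_diff_le i c μ z) z
  linarith

end Cube

end Literature.MathematicalPhysics.QuantumFieldTheory.Balaban1983to89.B9Cor36CutoffSecondDiff
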